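import Summits.HubbardSuperconductivity.HubbardSuperconductivity.Theorems.AnisotropyChordTransferFibre3GreenZero

/-!
# Route `AnisotropyChord` / H0 rotor rung: the one-magnon dispersion on integer representatives (toolkit for `DenMinRestLattice`)

For the lattice lemma of PartN32 (`DenMinRestLattice`, memo ROTOR-THEORY-21 §306, theory seat `hubbard-h0-rotor-theory-1`) the
dispersion `ε(k) = Σ_{i=1,2} (1 − cos(2π k_i/L))` is read on the symmetric integer representatives `r = valMinAbs(k_i) ∈ (−L/2, L/2]`:
`wInt r := 1 − cos(2πr/L)`.  This file proves: `eps1D = wInt ∘ valMinAbs` (`eps1D_eq_wInt`), `epsT k = wInt(x) + wInt(y)`, evenness,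
`wInt 0 = 0`, `wInt (±1) = ε₁`, `wInt (±2) = 2(1+c)ε₁`, `wInt (±3) = (1+2c)²ε₁` (`c = cos(2π/L)`, `ε₁ = 1 − c`), monotonicity
`3 ≤ |r| ≤ L/2 ⇒ wInt 3 ≤ wInt r`, `r ≠ 0 ⇒ ε₁ ≤ wInt r`, and the numerical facts `√2/2 ≤ c` (`L ≥ 8`) and
`5 + 2c ≤ (1+2c)² + 1` for `c ≥ √2/2` (`2|valMinAbs m| ≤ L` is `Literature.Probability.LatticeModels.two_mul_abs_valMinAbs_le`).
Prover seat `hubbard-h0-rotor-p1` g22; helper for stmt-HubbardSuperconductivity-19089 (`--supports`).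
-/

set_option linter.dupNamespace false
set_option autoImplicit false

noncomputable section

open scoped BigOperators

namespace Summit.HubbardSuperconductivity.HubbardSuperconductivity.Theorems.AnisotropyChord.Transfer.Fibre3

variable (L : ℕ) [NeZero L]

/-- the one-magnon dispersion on an integer representative: `1 − cos(2πr/L)`. [folklore] -/
def wInt (r : ℤ) : ℝ := 1 - Real.cos (2 * Real.pi * (r : ℝ) / L)

omit [NeZero L] in
/-- [folklore] -/
theorem wInt_nonneg (r : ℤ) : 0 ≤ wInt L r := by
  unfold wInt; linarith [Real.cos_le_one (2 * Real.pi * (r : ℝ) / L)]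

omit [NeZero L] in
/-- evenness. [folklore] -/
theorem wInt_neg (r : ℤ) : wInt L (-r) = wInt L r := by
  unfold wInt; push_cast; rw [show 2 * Real.pi * -(r : ℝ) / L = -(2 * Real.pi * (r : ℝ) / L) by ring, Real.cos_neg]

omit [NeZero L] in
/-- `wInt r = wInt |r|`. [folklore] -/
theorem wInt_natAbs (r : ℤ) : wInt L (r.natAbs : ℤ) = wInt L r := by
  rcases Int.natAbs_eq r with h | h
  · rw [← h]
  · conv_rhs => rw [h]
    rw [wInt_neg]

omit [NeZero L] in
/-- [folklore] -/
theorem wInt_zero : wInt L 0 = 0 := by unfold wInt; simp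

omit [NeZero L] in
/-- `wInt 1 = ε₁`. [folklore] -/
theorem wInt_one : wInt L 1 = eps1 L := by unfold wInt eps1; push_cast; ring_nf

omit [NeZero L] in
/-- `wInt 2 = 2(1 + c)ε₁`. [folklore] -/
theorem wInt_two : wInt L 2 = 2 * (1 + Real.cos (2 * Real.pi / L)) * eps1 L := by
  unfold wInt eps1
  push_cast
  rw [show 2 * Real.pi * (2 : ℝ) / L = 2 * (2 * Real.pi / L) by ring, Real.cos_two_mul]
  ring

omit [NeZero L] in
/-- `wInt 3 = (1 + 2c)² ε₁`. [folklore] -/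
theorem wInt_three : wInt L 3 = (1 + 2 * Real.cos (2 * Real.pi / L)) ^ 2 * eps1 L := by
  unfold wInt eps1
  push_cast
  rw [show 2 * Real.pi * (3 : ℝ) / L = 3 * (2 * Real.pi / L) by ring, Real.cos_three_mul]
  ring

omit [NeZero L] in
/-- monotonicity on representatives: `1 ≤ s ≤ |r|`, `2|r| ≤ L` ⇒ `wInt s ≤ wInt r`. [folklore] -/
theorem wInt_mono {s : ℕ} {r : ℤ} (hs : (s : ℤ) ≤ |r|) (hr : 2 * |r| ≤ (L : ℤ)) (hL : 0 < L) :
    wInt L (s : ℤ) ≤ wInt L r := by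
  rw [← wInt_natAbs L r]
  unfold wInt
  have hLr : (0 : ℝ) < L := by exact_mod_cast hL
  have habs : ((r.natAbs : ℤ) : ℝ) = (|r| : ℤ) := by rw [Int.natCast_natAbs]
  have h1 : (s : ℝ) ≤ ((|r| : ℤ) : ℝ) := by exact_mod_cast hs
  have h2 : 2 * ((|r| : ℤ) : ℝ) ≤ (L : ℝ) := by exact_mod_cast hr
  push_cast at habs h1 h2 ⊢
  rw [habs]
  have hx : 0 ≤ 2 * Real.pi * (s : ℝ) / L := by positivity
  have hy : 2 * Real.pi * (|(r : ℝ)|) / L ≤ Real.pi := by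
    rw [div_le_iff₀ hLr]; nlinarith [Real.pi_pos, abs_nonneg (r : ℝ)]
  have hxy : 2 * Real.pi * (s : ℝ) / L ≤ 2 * Real.pi * (|(r : ℝ)|) / L := by
    apply div_le_div_of_nonneg_right _ hLr.le; nlinarith [Real.pi_pos]
  have := Real.cos_le_cos_of_nonneg_of_le_pi hx hy hxy
  linarith

omit [NeZero L] in
/-- `r ≠ 0`, `2|r| ≤ L` ⇒ `ε₁ ≤ wInt r`. [folklore] -/
theorem eps1_le_wInt {r : ℤ} (hr0 : r ≠ 0) (hr : 2 * |r| ≤ (L : ℤ)) (hL : 0 < L) : eps1 L ≤ wInt L r := by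
  rw [← wInt_one]
  exact wInt_mono L (s := 1) (by have := Int.one_le_abs hr0; exact_mod_cast this) hr hL

omit [NeZero L] in
/-- `3 ≤ |r|`, `2|r| ≤ L` ⇒ `(1+2c)²ε₁ ≤ wInt r`. [folklore] -/
theorem wInt_three_le {r : ℤ} (h3 : 3 ≤ |r|) (hr : 2 * |r| ≤ (L : ℤ)) (hL : 0 < L) :
    (1 + 2 * Real.cos (2 * Real.pi / L)) ^ 2 * eps1 L ≤ wInt L r := by
  rw [← wInt_three]
  exact wInt_mono L (s := 3) (by exact_mod_cast h3) hr hL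

/-- **the dispersion on representatives:** `eps1D m = wInt (valMinAbs m)`. [folklore] -/
theorem eps1D_eq_wInt (m : ZMod L) : FreeGap.eps1D L m = wInt L m.valMinAbs := by
  unfold FreeGap.eps1D wInt
  rw [ZMod.valMinAbs_def_pos]
  split_ifs with h
  · push_cast; ring_nf
  · have hL : (L : ℝ) ≠ 0 := by exact_mod_cast (NeZero.ne L)
    push_cast
    rw [show 2 * Real.pi * ((m.val : ℝ) - (L : ℝ)) / L = 2 * Real.pi * (m.val : ℝ) / L - 2 * Real.pi by field_simp,
      Real.cos_sub_two_pi]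

/-- `epsT k = wInt(x) + wInt(y)` on representatives. [folklore] -/
theorem epsT_eq_wInt (k : Tor L) : epsT L k = wInt L k.1.valMinAbs + wInt L k.2.valMinAbs := by
  rw [← freeGap_eps_eq]; unfold FreeGap.eps; rw [eps1D_eq_wInt, eps1D_eq_wInt]

/-! ## The two numerical facts for `L ≥ 8` -/

omit [NeZero L] in
/-- `cos(2π/L) ≥ √2/2` for `L ≥ 8`. [folklore] -/
theorem sqrt2_div_two_le_cos (hL : 8 ≤ L) : Real.sqrt 2 / 2 ≤ Real.cos (2 * Real.pi / L) := by
  rw [← Real.cos_pi_div_four]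
  have hLr : (8 : ℝ) ≤ L := by exact_mod_cast hL
  apply Real.cos_le_cos_of_nonneg_of_le_pi (by positivity)
  · have : (0 : ℝ) < L := by linarith
    rw [div_le_iff₀ (by norm_num : (0:ℝ) < 4)]; nlinarith [Real.pi_pos]
  · have hLpos : (0 : ℝ) < L := by linarith
    rw [div_le_div_iff₀ hLpos (by norm_num : (0:ℝ) < 4)]; nlinarith [Real.pi_pos]

/-- `5 + 2c ≤ (1 + 2c)² + 1` for `c ≥ √2/2`. [folklore] -/
theorem key_ineq {c : ℝ} (hc : Real.sqrt 2 / 2 ≤ c) : 5 + 2 * c ≤ (1 + 2 * c) ^ 2 + 1 := by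
  have hs : Real.sqrt 2 ^ 2 = 2 := Real.sq_sqrt (by norm_num)
  have hs0 : 0 ≤ Real.sqrt 2 := Real.sqrt_nonneg 2
  have hs1 : 1 ≤ Real.sqrt 2 := by nlinarith
  nlinarith [mul_nonneg (by linarith : 0 ≤ 2 * c - Real.sqrt 2) (by linarith : 0 ≤ 2 * c + Real.sqrt 2)]

end Summit.HubbardSuperconductivity.HubbardSuperconductivity.Theorems.AnisotropyChord.Transfer.Fibre3

end
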